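import Literature.Analysis.Calculus.ConstrainedCriticalFamilyReal
import Literature.MathematicalPhysics.QuantumFieldTheory.Balaban1983to89.B15Prop1MinimiserFamilyPatching

/-!
# `Balaban1983to89.B15Prop1CriticalChartFromIFT` — [Balaban1985Variational] = «[15]», Thm 1 p. 279 («a unique critical orbit in the space (6)»), Sect. G pp. 305–309, Prop. 9 (190)
# p. 309; [Balaban1989LargeFieldI] = «[IV]», Prop. 1 p. 194 (last clause); [Balaban1988Convergent] = «[III]», (2.12) p. 256:
# A LOCAL HOLOMORPHIC CHART OF (2.12) MINIMISERS ON THE LEVEL-0 COMPLEX CONFIGURATION SPACE FROM THE COMPLEX IMPLICIT-FUNCTION THEOREM — the hypothesis `hloc` of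
# `B15Prop1MinimiserFamilyPatching.hMin_of_localCharts`, from a nondegenerate conjugation-symmetric complex Lagrange system in coordinates

Honest framing: statement-level skeleton of published theorems with citation tags; proofs where landed; nothing here is a claim about the
Yang–Mills mass gap.  Cell `pub-ymgap`, HUMAN RULING D-0149 (width seats), seat `pub-ymgap-dag-n12-w1` (g2; N12 = [B15]; U1a⁺ of the w1 lineage, U1A-CENSUS §4 item 1 (δ′));
count-neutral; N12 NOT discharged; finite 𝕋⁴ at fixed ε; nothing continuum ∕ OS ∕ mass-gap ∕ Clay.

WHY.  `hMin_of_localCharts` (this seat, `B15Prop1MinimiserFamilyPatching`) reduces the intrinsic analytic letter (J0′) of the N12∕s1 endpoints to LOCAL CHARTS: at every base field an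
open set `O` of level-0 complex configurations `Q` containing the base datum and a map `Γ` with entries ℂ-differentiable on `O`, bounded on `O`, which at every REAL `Q ∈ O` IS an
`SU(2)` configuration minimal for the (2.12) problem of the datum `M˙(Q)`.  Print obtains the analytic extension of `U_k(V)` in the axial gauge ([15] Sect. G, Prop. 9) from the
equations of the variational problem, which «are valid for Gᶜ-valued fields» (p. 307), and identifies its real values with THE minimiser through Thm 1's clause «this orbit is a
unique critical orbit in the space (6)».  THIS MODULE types that passage ABSTRACTLY IN COORDINATES: a complex coordinate space `E` (states) and `F` (constraint values) with
conjugations, a state chart `χ : E → (bond ↦ M₂(ℂ))` intertwining conjugation with the unitary real structure `θ(A) = (A⋆)⁻¹` and valued in `det = 1`, a ℂ-analytic action `a`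
and constraint `Φ` on `E` (equivariant), datum coordinates `κ` on the configuration space — and the complex Lagrange system at a REAL, ONTO, NONDEGENERATE constrained critical
base state `x₀`.  Then `Γ := χ ∘ γ ∘ κ` with `γ` the implicit critical family (`ConstrainedCriticalFamily.exists_criticalFamily_tangent_real`: holomorphic, fibre-wise critical in
the tangent form, REAL ON REAL) is such a chart, GIVEN the three transfers to NODE 00's predicates near the base point — (class) `χ x ∈ reg`, (fibre) `Φ x = κ Q ⇒ Ū(χ x) = Ū(Q)` on
`𝔹`, (critical) tangent-form criticality in coordinates ⇒ a criticality predicate `Crit` — and [15] Thm 1's uniqueness clause «in the class, on the fibre, critical ⇒ minimal» for the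
data near the base datum (DISPLAYED: `hT1u`).  The N12 instantiation (`E` = the complexified exponential chart at a minimiser with the gauge condition adjoined to `Φ`, `κ` = the
holomorphic logarithmic coordinates of the averages `iterMh` of this seat's g0 files, `a` = the trace-polynomial Wilson action) is the successor module; every hypothesis below is
shaped for it.

CONTENTS (theorems only; no `def`, no `instance`, no `sorry`).  §1 `mem_specialUnitaryGroup_of_theta_fixed` (`A = (A⋆)⁻¹`, `det A = 1` ⇒ `A ∈ SU(2)`), `norm_entry_le_one_of_theta_fixed`,
`differentiable_entry`.  §2 ★★★ `exists_localChart_of_criticalFamily` (the chart `(O, Γ)` with the three clauses of `hloc`, from the complex IFT data + transfers + `hT1u`).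
§3 `cplxVec_zero`, `datumC_coeField_zero`, ★★★ `hMin_of_criticalFamilies` — §2 at every base field `V_k` of a compact `K` (a FAMILY of complex Lagrange systems in fixed coordinate spaces
`E`, `F`, indexed by `V_k`) fed into `B15Prop1MinimiserFamilyPatching.hMin_of_localCharts`: the letter (J0′) `hMin` of p586362 ∕ p589595 with ONE radius `R`, for the chart
family `Q_k^{s*}(exp(iB′)·ext(exp(ip)V_k))` of [IV] Prop. 1 under `hext`.
HONEST SCOPE: generic calculus ∕ topology around part II of `ConstrainedCriticalFamily`; the transfers, the nondegeneracy (β), «DΦ onto» and [15] Thm 1's clause are DISPLAYED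
hypotheses; nothing of Bałaban's is asserted.
-/

noncomputable section

namespace Literature.MathematicalPhysics.QuantumFieldTheory.Balaban1983to89.B15Prop1CriticalChartFromIFT

open Set Metric Filter
open scoped Topology ContDiff ComplexConjugate
open Literature.Analysis.Calculus.ConstrainedCriticalFamily (exists_criticalFamily_real)
open Literature.MathematicalPhysics.QuantumFieldTheory.Balaban1983to89.Node00 (SU coeField coeField_apply)
open B15ComplexifiedDatumFamily (datumC datumC_real)
open B15Prop1MinimiserFamilyPatching (hMin_of_localCharts)
open Literature.MathematicalPhysics.QuantumFieldTheory.BalabanImbrieJaffe1984to88.BIJ85Eq453GaugeField (qsstarGIter0)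
open B15Prop1AnalyticExtClause (cplxVec)
open B15Prop1ChartCalculusSU2 (E3)
open B15Prop1ChartSU2 (su2Chart)
open B15ShellGauge193 (shellGauge)
open B15Extension193 (extend)
open B16Sect1Backgrounds (expMul expMul_zero)
open T4CubeChartGnomonic (SU2)
open T4Continuum B15DeterminingSets GaugeField
open scoped Matrix.Norms.L2Operator

/-! ## §1  The unitary real structure `θ(A) = (A⋆)⁻¹`: fixed points of determinant one are `SU(2)` matrices -/

section Theta

/-- **A `θ`-FIXED MATRIX OF DETERMINANT ONE IS SPECIAL UNITARY**: `A = (A⋆)⁻¹` and `det A = 1` ⇒ `A ∈ SU(2)` (`A⋆` is invertible, so `A·A⋆ = 1`).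
[cite: Balaban1985Variational, p.307 («Gᶜ-valued configurations»), (181) p.307] -/
theorem mem_specialUnitaryGroup_of_theta_fixed {A : Matrix (Fin 2) (Fin 2) ℂ} (hθ : A = (star A)⁻¹) (hdet : A.det = 1) :
    A ∈ Matrix.specialUnitaryGroup (Fin 2) ℂ := by
  rw [Matrix.mem_specialUnitaryGroup_iff, Matrix.mem_unitaryGroup_iff]
  refine ⟨?_, hdet⟩
  have hs : IsUnit (star A).det := by
    rw [Matrix.star_eq_conjTranspose, Matrix.det_conjTranspose, hdet, star_one]; exact isUnit_one
  calc A * star A = (star A)⁻¹ * star A := by rw [← hθ]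
    _ = 1 := Matrix.nonsing_inv_mul _ hs

/-- The entries of a `θ`-fixed matrix of determinant one have norm `≤ 1` (entries of a unitary matrix). [cite: Balaban1985Variational, p.307 (bookkeeping)] -/
theorem norm_entry_le_one_of_theta_fixed {A : Matrix (Fin 2) (Fin 2) ℂ} (hθ : A = (star A)⁻¹) (hdet : A.det = 1) (i j : Fin 2) : ‖A i j‖ ≤ 1 :=
  entry_norm_bound_of_unitary ((Matrix.mem_specialUnitaryGroup_iff.1 (mem_specialUnitaryGroup_of_theta_fixed hθ hdet)).1) i j

/-- An entry `A ↦ A i j` of `M₂(ℂ)` is ℂ-differentiable (a linear map on a finite-dimensional space). [cite: Balaban1985Averaging, (21) p.21 (bookkeeping)] -/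
theorem differentiable_entry (i j : Fin 2) : Differentiable ℂ (fun A : Matrix (Fin 2) (Fin 2) ℂ => A i j) :=
  (LinearMap.toContinuousLinearMap (Matrix.entryLinearMap ℂ ℂ i j)).differentiable

end Theta

/-! ## §2  The local chart of minimisers from the complex implicit critical family -/

section Chart

variable {P : Params}
  {E : Type*} [NormedAddCommGroup E] [NormedSpace ℂ E] [FiniteDimensional ℂ E]
  {F : Type*} [NormedAddCommGroup F] [NormedSpace ℂ F] [FiniteDimensional ℂ F]

/-- ★★★ **A LOCAL HOLOMORPHIC CHART OF (2.12) MINIMISERS FROM THE COMPLEX IMPLICIT-FUNCTION THEOREM.**  Coordinates: complex finite-dimensional `E` (states) and `F` (constraint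
values) with conjugations `cE`, `cF`; an action `a : E → ℂ` and a constraint `Φ : E → F` of class `C^{m+1}` at a base state `x₀` (`0 ≠ m ≠ ∞`; `m = ω`: analytic), EQUIVARIANT
(`a ∘ cE = conj ∘ a`, `Φ ∘ cE = cF ∘ Φ`); `x₀` REAL (`cE x₀ = x₀`) and a constrained critical point in Lagrange form with `DΦ(x₀)` ONTO and the Lagrange Hessian NONDEGENERATE on
`ker DΦ(x₀)` (the letter (β)); a STATE CHART `χ : E → (bond ↦ M₂(ℂ))`, ℂ-differentiable near `x₀`, intertwining `cE` with `θ(A) = (A⋆)⁻¹` and valued in `det = 1` (so real states are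
`SU(2)` configurations); DATUM COORDINATES `κ` on the level-0 complex configurations, ℂ-differentiable near the base datum `↑Q₀`, with `κ ↑Q₀ = Φ x₀` and real (`cF`-fixed) on the `SU(2)`
configurations near `↑Q₀`; the TRANSFERS near `x₀` — a state `x` with `χ x = ↑U′`, `Φ x = κ ↑Q′` and tangent-form criticality (`Da(x)` kills `ker DΦ(x)`) gives `U′ ∈ reg`, `Ū(U′) = Ū(Q′)` on `𝔹`,
and `Crit Q′ U′` —; and [15] THM 1's UNIQUENESS CLAUSE near the base datum: in the class, on the fibre, `Crit` ⇒ minimal (`hT1u`, DISPLAYED).  CONCLUSION: an open `O ∋ ↑Q₀` and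
`Γ := χ ∘ γ ∘ κ` (`γ` the implicit critical family, real on real) with entries ℂ-differentiable on `O`, bounded by `𝓐₀ > 1` on `O`, and at every REAL `↑Q′ ∈ O` equal to `↑U′` for a
MINIMAL CONFIGURATION `U′` of the datum `Ū(Q′)` — the hypothesis `hloc` of `B15Prop1MinimiserFamilyPatching.hMin_of_localCharts` at the base field behind `Q₀`.
[cite: Balaban1985Variational, Thm 1 p.279, Sect. G pp.305–307, (181) p.307, Prop. 9 (190) p.309; Balaban1989LargeFieldI, Prop. 1 p.194 (last clause); Balaban1988Convergent, (2.12) p.256; LuenbergerYe2008, §10.7 pp.306–307] -/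
theorem exists_localChart_of_criticalFamily (av : ∀ j, Averaging P j SU2) (reg : Set (GaugeField P 0 SU2)) (𝔹 : DetSet P)
    (cE : E →L⋆[ℂ] E) (cF : F →L⋆[ℂ] F) (hcE : ∀ x, cE (cE x) = x) (hcF : ∀ y, cF (cF y) = y)
    {a : E → ℂ} {Φ : E → F} {x₀ : E} {ℓ₀ : F →L[ℂ] ℂ} {m : WithTop ℕ∞} (hm : m ≠ 0) (hm' : m ≠ (⊤ : ℕ∞))
    (ha : ContDiffAt ℂ (m + 1) a x₀) (hΦ : ContDiffAt ℂ (m + 1) Φ x₀)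
    (hcrit : fderiv ℂ a x₀ = ℓ₀.comp (fderiv ℂ Φ x₀))
    (honto : Function.Surjective (fderiv ℂ Φ x₀))
    (hnondeg : ∀ s : E, fderiv ℂ Φ x₀ s = 0 →
      (∀ t : E, fderiv ℂ Φ x₀ t = 0 → fderiv ℂ (fderiv ℂ a) x₀ s t - ℓ₀ (fderiv ℂ (fderiv ℂ Φ) x₀ s t) = 0) → s = 0)
    (haE : ∀ x, a (cE x) = conj (a x)) (hΦE : ∀ x, Φ (cE x) = cF (Φ x)) (hx₀ : cE x₀ = x₀)
    -- the state chart
    (χ : E → PBond P 0 → Matrix (Fin 2) (Fin 2) ℂ) (hχ : ∀ᶠ x in 𝓝 x₀, DifferentiableAt ℂ χ x)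
    (hχθ : ∀ x b, χ (cE x) b = (star (χ x b))⁻¹) (hχdet : ∀ x b, (χ x b).det = 1)
    -- the datum coordinates
    (κ : (PBond P 0 → Matrix (Fin 2) (Fin 2) ℂ) → F) {Q₀ : GaugeField P 0 SU2} (hκ₀ : κ (coeField Q₀) = Φ x₀)
    (hκ : ∀ᶠ Q in 𝓝 (coeField Q₀), DifferentiableAt ℂ κ Q)
    (hκreal : ∀ᶠ Q in 𝓝 (coeField Q₀), ∀ Q' : GaugeField P 0 SU2, coeField Q' = Q → cF (κ Q) = κ Q)
    -- the transfers to NODE 00's predicates, near the base state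
    (Crit : GaugeField P 0 SU2 → GaugeField P 0 SU2 → Prop)
    (htransfer : ∀ᶠ x in 𝓝 x₀, ∀ (U' Q' : GaugeField P 0 SU2) (μ : F →L[ℂ] ℂ), χ x = coeField U' → Φ x = κ (coeField Q') →
      fderiv ℂ a x = μ.comp (fderiv ℂ Φ x) → (starL ℂ : ℂ ≃L⋆[ℂ] ℂ).toContinuousLinearMap.comp (μ.comp cF) = μ →
        U' ∈ reg ∧ AgreeOn 𝔹 (avgFamily av U') (avgFamily av Q') ∧ Crit Q' U')
    -- [15] Thm 1: «a unique critical orbit in the space (6)», for the data near the base datum (DISPLAYED)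
    (hT1u : ∀ᶠ Q in 𝓝 (coeField Q₀), ∀ U' Q' : GaugeField P 0 SU2, coeField Q' = Q →
      U' ∈ reg → AgreeOn 𝔹 (avgFamily av U') (avgFamily av Q') → Crit Q' U' → IsMinimizer av reg 𝔹 (avgFamily av Q') U')
    {𝓐₀ : ℝ} (h𝓐₀ : 1 < 𝓐₀) :
    ∃ O : Set (PBond P 0 → Matrix (Fin 2) (Fin 2) ℂ), IsOpen O ∧ coeField Q₀ ∈ O ∧
      ∃ Γ : (PBond P 0 → Matrix (Fin 2) (Fin 2) ℂ) → PBond P 0 → Matrix (Fin 2) (Fin 2) ℂ,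
        (∀ b i j, DifferentiableOn ℂ (fun Q => Γ Q b i j) O) ∧
        (∀ Q ∈ O, ∀ b i j, ‖Γ Q b i j‖ ≤ 𝓐₀) ∧
        ∀ Q' : GaugeField P 0 SU2, coeField Q' ∈ O →
          ∃ U' : GaugeField P 0 SU2, (∀ b, Γ (coeField Q') b = ((U' b : SU2) : Matrix (Fin 2) (Fin 2) ℂ)) ∧
            IsMinimizer av reg 𝔹 (avgFamily av Q') U' := by
  -- the implicit critical family, real on real (with its multipliers)
  obtain ⟨γ, Λ, -, hγ0, -, hγc, -, hid, -, -, -, hreal⟩ :=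
    exists_criticalFamily_real hm ha hΦ hcrit honto hnondeg cE cF hcE hcF haE hΦE hx₀
  have hγ : ∀ᶠ g in 𝓝 (Φ x₀), Φ (γ g) = g ∧ ContDiffAt ℂ m γ g ∧
      fderiv ℂ a (γ g) = (Λ g).comp (fderiv ℂ Φ (γ g)) ∧
      (cF g = g → cE (γ g) = γ g ∧ (starL ℂ : ℂ ≃L⋆[ℂ] ℂ).toContinuousLinearMap.comp ((Λ g).comp cF) = Λ g) := by
    filter_upwards [hid, hγc.eventually hm', hreal] with g hg hcg hrg
    exact ⟨hg.1, hcg, hg.2, hrg⟩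
  -- neighbourhoods: in `g`, the family clauses and `γ g` in the good state set; in `Q`, everything through `κ`
  have hγt : Tendsto γ (𝓝 (Φ x₀)) (𝓝 x₀) := by
    have h := hγc.continuousAt.tendsto
    rwa [hγ0] at h
  have hG : ∀ᶠ g in 𝓝 (Φ x₀), (Φ (γ g) = g ∧ ContDiffAt ℂ m γ g ∧
      fderiv ℂ a (γ g) = (Λ g).comp (fderiv ℂ Φ (γ g)) ∧
      (cF g = g → cE (γ g) = γ g ∧ (starL ℂ : ℂ ≃L⋆[ℂ] ℂ).toContinuousLinearMap.comp ((Λ g).comp cF) = Λ g)) ∧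
      DifferentiableAt ℂ χ (γ g) ∧
      (∀ (U' Q' : GaugeField P 0 SU2) (μ : F →L[ℂ] ℂ), χ (γ g) = coeField U' → Φ (γ g) = κ (coeField Q') →
        fderiv ℂ a (γ g) = μ.comp (fderiv ℂ Φ (γ g)) → (starL ℂ : ℂ ≃L⋆[ℂ] ℂ).toContinuousLinearMap.comp (μ.comp cF) = μ →
          U' ∈ reg ∧ AgreeOn 𝔹 (avgFamily av U') (avgFamily av Q') ∧ Crit Q' U') :=
    hγ.and ((hγt.eventually hχ).and (hγt.eventually htransfer))
  have hκt : Tendsto κ (𝓝 (coeField Q₀)) (𝓝 (Φ x₀)) := by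
    have h := hκ.self_of_nhds.continuousAt.tendsto
    rwa [hκ₀] at h
  -- continuity of `Γ = χ ∘ γ ∘ κ` at the base datum and the entry bound there
  have hΓc : ContinuousAt (fun Q => χ (γ (κ Q))) (coeField Q₀) := by
    have h1 : ContinuousAt χ (γ (κ (coeField Q₀))) := by
      rw [hκ₀, hγ0]; exact hχ.self_of_nhds.continuousAt
    have h2 : ContinuousAt γ (κ (coeField Q₀)) := by rw [hκ₀]; exact hγc.continuousAt
    have h3 : ContinuousAt (fun Q => γ (κ Q)) (coeField Q₀) := h2.comp hκ.self_of_nhds.continuousAt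
    exact ContinuousAt.comp (f := fun Q => γ (κ Q)) h1 h3
  have hbase : ∀ b i j, ‖χ (γ (κ (coeField Q₀))) b i j‖ < 𝓐₀ := fun b i j => by
    rw [hκ₀, hγ0]
    have hθ : χ x₀ b = (star (χ x₀ b))⁻¹ := by
      have h := hχθ x₀ b
      rwa [hx₀] at h
    exact lt_of_le_of_lt (norm_entry_le_one_of_theta_fixed hθ (hχdet x₀ b) i j) h𝓐₀
  have hbound : ∀ᶠ Q in 𝓝 (coeField Q₀), ∀ b i j, ‖χ (γ (κ Q)) b i j‖ < 𝓐₀ := by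
    refine eventually_all.2 fun b => eventually_all.2 fun i => eventually_all.2 fun j => ?_
    have hc : ContinuousAt (fun Q => ‖χ (γ (κ Q)) b i j‖) (coeField Q₀) :=
      ((continuous_apply j).continuousAt.comp ((continuous_apply i).continuousAt.comp
        ((continuous_apply b).continuousAt.comp hΓc))).norm
    exact hc.eventually (gt_mem_nhds (hbase b i j))
  -- the good set of data and the open chart domain
  have hS : ∀ᶠ Q in 𝓝 (coeField Q₀), DifferentiableAt ℂ κ Q ∧ (∀ b i j, ‖χ (γ (κ Q)) b i j‖ < 𝓐₀) ∧
      (∀ Q' : GaugeField P 0 SU2, coeField Q' = Q → cF (κ Q) = κ Q) ∧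
      (∀ U' Q' : GaugeField P 0 SU2, coeField Q' = Q →
        U' ∈ reg → AgreeOn 𝔹 (avgFamily av U') (avgFamily av Q') → Crit Q' U' → IsMinimizer av reg 𝔹 (avgFamily av Q') U') ∧
      ((Φ (γ (κ Q)) = κ Q ∧ ContDiffAt ℂ m γ (κ Q) ∧
        fderiv ℂ a (γ (κ Q)) = (Λ (κ Q)).comp (fderiv ℂ Φ (γ (κ Q))) ∧
        (cF (κ Q) = κ Q → cE (γ (κ Q)) = γ (κ Q) ∧
          (starL ℂ : ℂ ≃L⋆[ℂ] ℂ).toContinuousLinearMap.comp ((Λ (κ Q)).comp cF) = Λ (κ Q))) ∧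
        DifferentiableAt ℂ χ (γ (κ Q)) ∧
        (∀ (U' Q' : GaugeField P 0 SU2) (μ : F →L[ℂ] ℂ), χ (γ (κ Q)) = coeField U' → Φ (γ (κ Q)) = κ (coeField Q') →
          fderiv ℂ a (γ (κ Q)) = μ.comp (fderiv ℂ Φ (γ (κ Q))) → (starL ℂ : ℂ ≃L⋆[ℂ] ℂ).toContinuousLinearMap.comp (μ.comp cF) = μ →
            U' ∈ reg ∧ AgreeOn 𝔹 (avgFamily av U') (avgFamily av Q') ∧ Crit Q' U')) :=
    hκ.and (hbound.and (hκreal.and (hT1u.and (hκt.eventually hG))))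
  obtain ⟨S, hSsub, hSopen, hSmem⟩ := _root_.mem_nhds_iff.1 hS
  refine ⟨S, hSopen, hSmem, fun Q => χ (γ (κ Q)), fun b i j => ?_, fun Q hQ b i j => le_of_lt ((hSsub hQ).2.1 b i j), fun Q' hQ' => ?_⟩
  · -- differentiability of an entry of `Γ` on `S`
    intro Q hQ
    obtain ⟨hκQ, -, -, -, ⟨-, hγQ, -, -⟩, hχQ, -⟩ := hSsub hQ
    have h : DifferentiableAt ℂ (fun Q => χ (γ (κ Q))) Q := hχQ.comp Q ((hγQ.differentiableAt hm).comp Q hκQ)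
    have hb : DifferentiableAt ℂ (fun Q => χ (γ (κ Q)) b) Q := (differentiableAt_pi.1 h) b
    exact (((differentiable_entry i j) _).comp Q hb).differentiableWithinAt
  · -- a real datum in `S`: the family member is a real state, hence an `SU(2)` configuration, on the fibre, critical, in the class ⇒ minimal
    obtain ⟨-, -, hκr, hT, ⟨hfib, -, hlag, hrealQ⟩, -, htr⟩ := hSsub hQ'
    obtain ⟨hfix, hμ⟩ := hrealQ (hκr Q' rfl)
    have hmem : ∀ b, χ (γ (κ (coeField Q'))) b ∈ Matrix.specialUnitaryGroup (Fin 2) ℂ := fun b => by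
      refine mem_specialUnitaryGroup_of_theta_fixed ?_ (hχdet _ b)
      have h := hχθ (γ (κ (coeField Q'))) b
      rwa [hfix] at h
    let U' : GaugeField P 0 SU2 := fun b => ⟨χ (γ (κ (coeField Q'))) b, hmem b⟩
    have hU' : χ (γ (κ (coeField Q'))) = coeField U' := funext fun b => rfl
    obtain ⟨hreg, hagree, hcritQ⟩ := htr U' Q' (Λ (κ (coeField Q'))) hU' hfib hlag hμ
    exact ⟨U', fun b => rfl, hT U' Q' rfl hreg hagree hcritQ⟩

end Chart

/-! ## §3  The letter (J0′) `hMin` from a family of complex Lagrange systems indexed by the base field -/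

section Record

variable {P : Params} {k : ℕ}
  {E : Type*} [NormedAddCommGroup E] [NormedSpace ℂ E] [FiniteDimensional ℂ E]
  {F : Type*} [NormedAddCommGroup F] [NormedSpace ℂ F] [FiniteDimensional ℂ F]

/-- The complexification of the zero bond field is zero. [cite: Balaban1989LargeFieldI, Prop. 1 p.194 (bookkeeping)] -/
theorem cplxVec_zero : cplxVec (0 : VecField P k E3) = 0 := by
  funext b; ext i; simp [cplxVec]

/-- **THE BASE DATUM**: at `(p, B′) = (0, 0)` the complexified datum of the chart family is the matrix field of `Q_k^{s*}(ext V_k)` (under `hext`). [cite: Balaban1989LargeFieldI, (1.74) p.192, Prop. 1 p.194; Balaban1988Convergent, (2.14) p.257] -/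
theorem datumC_coeField_zero (Λ : Set (Site P k)) (lo hi : Fin P.d → ℤ) (ext : GaugeField P k SU2 → GaugeField P k SU2)
    (hext : ∀ W, ext W = extend Λ (shellGauge W lo hi) W) (Vk : GaugeField P k SU2) :
    datumC Λ lo hi (coeField Vk) (0 : VecField P k (EuclideanSpace ℂ (Fin 3))) (0 : VecField P k (EuclideanSpace ℂ (Fin 3))) =
      coeField (qsstarGIter0 k (ext Vk)) := by
  rw [← cplxVec_zero, datumC_real, expMul_zero, expMul_zero, ← hext]

/-- ★★★ **THE LETTER (J0′) `hMin` OF p586362 ∕ p589595 FROM A FAMILY OF COMPLEX LAGRANGE SYSTEMS INDEXED BY THE BASE FIELD.**  For the chart family `Q_k^{s*}(exp(iB′)·ext(exp(ip)V_k))`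
of [IV] Prop. 1 (`ext = extend Λ (shellGauge · lo hi)`, any averaging `av`, class `reg`, determining set `𝔹`) and a compact set `K` of base fields: suppose that in FIXED complex coordinate
spaces `E` (states) and `F` (constraint values) with conjugations `cE`, `cF`, every `V_k ∈ K` carries the data of `exists_localChart_of_criticalFamily` at the base datum `Q_k^{s*}(ext V_k)`
— an equivariant complex Lagrange system `(a V_k, Φ V_k)` at a real, onto, nondegenerate constrained critical state `x₀ V_k`, a state chart `χ V_k`, datum coordinates `κ V_k`, the
transfers, and [15] Thm 1's uniqueness clause near the base datum (DISPLAYED).  Then ONE radius `R > 0` serves every `V_k ∈ K`: the three clauses of `hMin` hold on `ball 0 R` —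
§2 at each `V_k`, then `B15Prop1MinimiserFamilyPatching.hMin_of_localCharts` (compactness).
[cite: Balaban1985Variational, Thm 1 p.279, Sect. G pp.305–307, Prop. 9 (190) p.309; Balaban1989LargeFieldI, (1.74) p.192, Prop. 1 p.194 (last clause); Balaban1988Convergent, (2.11)–(2.14) pp.256–257; LuenbergerYe2008, §10.7 pp.306–307] -/
theorem hMin_of_criticalFamilies (Λ : Set (Site P k)) (lo hi : Fin P.d → ℤ)
    (av : ∀ j, Averaging P j SU2) (reg : Set (GaugeField P 0 SU2)) (𝔹 : DetSet P)
    (ext : GaugeField P k SU2 → GaugeField P k SU2) (hext : ∀ W, ext W = extend Λ (shellGauge W lo hi) W)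
    {K : Set (GaugeField P k SU2)} (hK : IsCompact K) {𝓐₀ : ℝ} (h𝓐₀ : 1 < 𝓐₀)
    (cE : E →L⋆[ℂ] E) (cF : F →L⋆[ℂ] F) (hcE : ∀ x, cE (cE x) = x) (hcF : ∀ y, cF (cF y) = y)
    {m : WithTop ℕ∞} (hm : m ≠ 0) (hm' : m ≠ (⊤ : ℕ∞))
    (a : GaugeField P k SU2 → E → ℂ) (Φ : GaugeField P k SU2 → E → F) (x₀ : GaugeField P k SU2 → E)
    (ℓ₀ : GaugeField P k SU2 → (F →L[ℂ] ℂ))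
    (χ : GaugeField P k SU2 → E → PBond P 0 → Matrix (Fin 2) (Fin 2) ℂ)
    (κ : GaugeField P k SU2 → (PBond P 0 → Matrix (Fin 2) (Fin 2) ℂ) → F)
    (Crit : GaugeField P 0 SU2 → GaugeField P 0 SU2 → Prop)
    -- the complex Lagrange system at each base field: class, criticality, onto, nondegenerate, equivariant, real base state
    (hsys : ∀ Vk ∈ K, ContDiffAt ℂ (m + 1) (a Vk) (x₀ Vk) ∧ ContDiffAt ℂ (m + 1) (Φ Vk) (x₀ Vk) ∧
      fderiv ℂ (a Vk) (x₀ Vk) = (ℓ₀ Vk).comp (fderiv ℂ (Φ Vk) (x₀ Vk)) ∧ Function.Surjective (fderiv ℂ (Φ Vk) (x₀ Vk)) ∧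
      (∀ s : E, fderiv ℂ (Φ Vk) (x₀ Vk) s = 0 →
        (∀ t : E, fderiv ℂ (Φ Vk) (x₀ Vk) t = 0 →
          fderiv ℂ (fderiv ℂ (a Vk)) (x₀ Vk) s t - (ℓ₀ Vk) (fderiv ℂ (fderiv ℂ (Φ Vk)) (x₀ Vk) s t) = 0) → s = 0) ∧
      (∀ x, a Vk (cE x) = conj (a Vk x)) ∧ (∀ x, Φ Vk (cE x) = cF (Φ Vk x)) ∧ cE (x₀ Vk) = x₀ Vk)
    -- the state charts
    (hχ : ∀ Vk ∈ K, (∀ᶠ x in 𝓝 (x₀ Vk), DifferentiableAt ℂ (χ Vk) x) ∧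
      (∀ x b, χ Vk (cE x) b = (star (χ Vk x b))⁻¹) ∧ ∀ x b, (χ Vk x b).det = 1)
    -- the datum coordinates
    (hκ : ∀ Vk ∈ K, κ Vk (coeField (qsstarGIter0 k (ext Vk))) = Φ Vk (x₀ Vk) ∧
      (∀ᶠ Q in 𝓝 (coeField (qsstarGIter0 k (ext Vk))), DifferentiableAt ℂ (κ Vk) Q) ∧
      ∀ᶠ Q in 𝓝 (coeField (qsstarGIter0 k (ext Vk))), ∀ Q' : GaugeField P 0 SU2, coeField Q' = Q → cF (κ Vk Q) = κ Vk Q)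
    -- the transfers
    (htransfer : ∀ Vk ∈ K, ∀ᶠ x in 𝓝 (x₀ Vk), ∀ (U' Q' : GaugeField P 0 SU2) (μ : F →L[ℂ] ℂ), χ Vk x = coeField U' →
      Φ Vk x = κ Vk (coeField Q') → fderiv ℂ (a Vk) x = μ.comp (fderiv ℂ (Φ Vk) x) →
        (starL ℂ : ℂ ≃L⋆[ℂ] ℂ).toContinuousLinearMap.comp (μ.comp cF) = μ →
        U' ∈ reg ∧ AgreeOn 𝔹 (avgFamily av U') (avgFamily av Q') ∧ Crit Q' U')
    -- [15] Thm 1: «a unique critical orbit in the space (6)», near each base datum (DISPLAYED)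
    (hT1u : ∀ Vk ∈ K, ∀ᶠ Q in 𝓝 (coeField (qsstarGIter0 k (ext Vk))), ∀ U' Q' : GaugeField P 0 SU2, coeField Q' = Q →
      U' ∈ reg → AgreeOn 𝔹 (avgFamily av U') (avgFamily av Q') → Crit Q' U' → IsMinimizer av reg 𝔹 (avgFamily av Q') U') :
    ∃ R : ℝ, 0 < R ∧ ∀ Vk ∈ K,
      ∃ Ũ : VecField P k (EuclideanSpace ℂ (Fin 3)) × VecField P k (EuclideanSpace ℂ (Fin 3)) → PBond P 0 → Matrix (Fin 2) (Fin 2) ℂ,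
        (∀ b i j, DifferentiableOn ℂ (fun z => Ũ z b i j) (ball 0 R)) ∧
        (∀ z ∈ ball (0 : VecField P k (EuclideanSpace ℂ (Fin 3)) × VecField P k (EuclideanSpace ℂ (Fin 3))) R, ∀ b i j, ‖Ũ z b i j‖ ≤ 𝓐₀) ∧
        ∀ p B' : VecField P k E3, ‖p‖ < R → ‖B'‖ < R → ∃ U' : GaugeField P 0 SU2,
          (∀ b, Ũ (cplxVec p, cplxVec B') b = ((U' b : SU2) : Matrix (Fin 2) (Fin 2) ℂ)) ∧
            IsMinimizer av reg 𝔹 (avgFamily av (qsstarGIter0 k (expMul su2Chart B' (ext (expMul su2Chart p Vk))))) U' := by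
  refine hMin_of_localCharts Λ lo hi av reg 𝔹 ext hK fun Vk hVk => ?_
  obtain ⟨ha, hΦ, hcrit, honto, hnondeg, haE, hΦE, hx₀⟩ := hsys Vk hVk
  obtain ⟨hχd, hχθ, hχdet⟩ := hχ Vk hVk
  obtain ⟨hκ₀, hκd, hκreal⟩ := hκ Vk hVk
  obtain ⟨O, hO, hmem, Γ, hΓd, hΓb, hΓr⟩ := exists_localChart_of_criticalFamily av reg 𝔹 cE cF hcE hcF hm hm' ha hΦ hcrit honto hnondeg
    haE hΦE hx₀ (χ Vk) hχd hχθ hχdet (κ Vk) hκ₀ hκd hκreal Crit (htransfer Vk hVk) (hT1u Vk hVk) h𝓐₀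
  refine ⟨O, hO, by rwa [datumC_coeField_zero Λ lo hi ext hext], Γ, hΓd, hΓb, fun p B' Vk' hQ' => ?_⟩
  have hreal : datumC Λ lo hi (coeField Vk') (cplxVec p) (cplxVec B') =
      coeField (qsstarGIter0 k (expMul su2Chart B' (ext (expMul su2Chart p Vk')))) := by
    rw [datumC_real, ← hext]
  rw [hreal] at hQ' ⊢
  exact hΓr _ hQ'

end Record

/-! ## §4  (v1.1, append-only) The LOCALISED transfers: the fibre∕class∕criticality clause asked only near the PAIR (base state, base datum)

In v1 (`exists_localChart_of_criticalFamily`) the transfer `htransfer` quantifies over ALL data `Q′` with `Φ x = κ ↑Q′`; the N12 datum coordinates (`B15Prop1DatumCoordinates`) are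
injective only NEAR the base datum (the logarithmic chart of `SL₂(ℂ)` is local), so the usable edition localises the transfer in the pair `(x, Q) → (x₀, ↑Q₀)`.  Same proof; the chart
domain is cut down so that `(γ (κ Q), Q)` stays in the transfer's neighbourhood. -/

section ChartLocal

variable {P : Params}
  {E : Type*} [NormedAddCommGroup E] [NormedSpace ℂ E] [FiniteDimensional ℂ E]
  {F : Type*} [NormedAddCommGroup F] [NormedSpace ℂ F] [FiniteDimensional ℂ F]

/-- ★★★ **A LOCAL HOLOMORPHIC CHART OF (2.12) MINIMISERS FROM THE COMPLEX IMPLICIT-FUNCTION THEOREM — LOCALISED TRANSFERS.**  As `exists_localChart_of_criticalFamily`, with the transfer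
hypothesis asked only for pairs `(x, Q)` near `(x₀, ↑Q₀)`: «`χ x = ↑U′`, `↑Q′ = Q`, `Φ x = κ Q`, `Da(x) = μ ∘ DΦ(x)` with `μ` real ⇒ `U′ ∈ reg ∧ Ū(U′) = Ū(Q′) on 𝔹 ∧ Crit Q′ U′`» — the form the
N12 datum coordinates supply (`B15Prop1DatumCoordinates.eventually_agreeOn_of_datumCoord_eq`). [cite: Balaban1985Variational, Thm 1 p.279, Sect. G pp.305–307, (181) p.307, Prop. 9 (190) p.309; Balaban1989LargeFieldI, Prop. 1 p.194 (last clause); Balaban1988Convergent, (2.12) p.256; LuenbergerYe2008, §10.7 pp.306–307] -/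
theorem exists_localChart_of_criticalFamily_local (av : ∀ j, Averaging P j SU2) (reg : Set (GaugeField P 0 SU2)) (𝔹 : DetSet P)
    (cE : E →L⋆[ℂ] E) (cF : F →L⋆[ℂ] F) (hcE : ∀ x, cE (cE x) = x) (hcF : ∀ y, cF (cF y) = y)
    {a : E → ℂ} {Φ : E → F} {x₀ : E} {ℓ₀ : F →L[ℂ] ℂ} {m : WithTop ℕ∞} (hm : m ≠ 0) (hm' : m ≠ (⊤ : ℕ∞))
    (ha : ContDiffAt ℂ (m + 1) a x₀) (hΦ : ContDiffAt ℂ (m + 1) Φ x₀)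
    (hcrit : fderiv ℂ a x₀ = ℓ₀.comp (fderiv ℂ Φ x₀))
    (honto : Function.Surjective (fderiv ℂ Φ x₀))
    (hnondeg : ∀ s : E, fderiv ℂ Φ x₀ s = 0 →
      (∀ t : E, fderiv ℂ Φ x₀ t = 0 → fderiv ℂ (fderiv ℂ a) x₀ s t - ℓ₀ (fderiv ℂ (fderiv ℂ Φ) x₀ s t) = 0) → s = 0)
    (haE : ∀ x, a (cE x) = conj (a x)) (hΦE : ∀ x, Φ (cE x) = cF (Φ x)) (hx₀ : cE x₀ = x₀)
    (χ : E → PBond P 0 → Matrix (Fin 2) (Fin 2) ℂ) (hχ : ∀ᶠ x in 𝓝 x₀, DifferentiableAt ℂ χ x)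
    (hχθ : ∀ x b, χ (cE x) b = (star (χ x b))⁻¹) (hχdet : ∀ x b, (χ x b).det = 1)
    (κ : (PBond P 0 → Matrix (Fin 2) (Fin 2) ℂ) → F) {Q₀ : GaugeField P 0 SU2} (hκ₀ : κ (coeField Q₀) = Φ x₀)
    (hκ : ∀ᶠ Q in 𝓝 (coeField Q₀), DifferentiableAt ℂ κ Q)
    (hκreal : ∀ᶠ Q in 𝓝 (coeField Q₀), ∀ Q' : GaugeField P 0 SU2, coeField Q' = Q → cF (κ Q) = κ Q)
    (Crit : GaugeField P 0 SU2 → GaugeField P 0 SU2 → Prop)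
    -- the transfers, LOCALISED in the pair (state, datum)
    (htransfer : ∀ᶠ w in 𝓝 (x₀, coeField Q₀), ∀ (U' Q' : GaugeField P 0 SU2) (μ : F →L[ℂ] ℂ), χ w.1 = coeField U' → coeField Q' = w.2 →
      Φ w.1 = κ w.2 → fderiv ℂ a w.1 = μ.comp (fderiv ℂ Φ w.1) → (starL ℂ : ℂ ≃L⋆[ℂ] ℂ).toContinuousLinearMap.comp (μ.comp cF) = μ →
        U' ∈ reg ∧ AgreeOn 𝔹 (avgFamily av U') (avgFamily av Q') ∧ Crit Q' U')
    (hT1u : ∀ᶠ Q in 𝓝 (coeField Q₀), ∀ U' Q' : GaugeField P 0 SU2, coeField Q' = Q →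
      U' ∈ reg → AgreeOn 𝔹 (avgFamily av U') (avgFamily av Q') → Crit Q' U' → IsMinimizer av reg 𝔹 (avgFamily av Q') U')
    {𝓐₀ : ℝ} (h𝓐₀ : 1 < 𝓐₀) :
    ∃ O : Set (PBond P 0 → Matrix (Fin 2) (Fin 2) ℂ), IsOpen O ∧ coeField Q₀ ∈ O ∧
      ∃ Γ : (PBond P 0 → Matrix (Fin 2) (Fin 2) ℂ) → PBond P 0 → Matrix (Fin 2) (Fin 2) ℂ,
        (∀ b i j, DifferentiableOn ℂ (fun Q => Γ Q b i j) O) ∧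
        (∀ Q ∈ O, ∀ b i j, ‖Γ Q b i j‖ ≤ 𝓐₀) ∧
        ∀ Q' : GaugeField P 0 SU2, coeField Q' ∈ O →
          ∃ U' : GaugeField P 0 SU2, (∀ b, Γ (coeField Q') b = ((U' b : SU2) : Matrix (Fin 2) (Fin 2) ℂ)) ∧
            IsMinimizer av reg 𝔹 (avgFamily av Q') U' := by
  -- the implicit critical family, real on real (with its multipliers)
  obtain ⟨γ, Λ, -, hγ0, -, hγc, -, hid, -, -, -, hreal⟩ :=
    exists_criticalFamily_real hm ha hΦ hcrit honto hnondeg cE cF hcE hcF haE hΦE hx₀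
  have hγ : ∀ᶠ g in 𝓝 (Φ x₀), Φ (γ g) = g ∧ ContDiffAt ℂ m γ g ∧
      fderiv ℂ a (γ g) = (Λ g).comp (fderiv ℂ Φ (γ g)) ∧
      (cF g = g → cE (γ g) = γ g ∧ (starL ℂ : ℂ ≃L⋆[ℂ] ℂ).toContinuousLinearMap.comp ((Λ g).comp cF) = Λ g) := by
    filter_upwards [hid, hγc.eventually hm', hreal] with g hg hcg hrg
    exact ⟨hg.1, hcg, hg.2, hrg⟩
  have hγt : Tendsto γ (𝓝 (Φ x₀)) (𝓝 x₀) := by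
    have h := hγc.continuousAt.tendsto
    rwa [hγ0] at h
  have hG : ∀ᶠ g in 𝓝 (Φ x₀), (Φ (γ g) = g ∧ ContDiffAt ℂ m γ g ∧
      fderiv ℂ a (γ g) = (Λ g).comp (fderiv ℂ Φ (γ g)) ∧
      (cF g = g → cE (γ g) = γ g ∧ (starL ℂ : ℂ ≃L⋆[ℂ] ℂ).toContinuousLinearMap.comp ((Λ g).comp cF) = Λ g)) ∧
      DifferentiableAt ℂ χ (γ g) := hγ.and (hγt.eventually hχ)
  have hκt : Tendsto κ (𝓝 (coeField Q₀)) (𝓝 (Φ x₀)) := by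
    have h := hκ.self_of_nhds.continuousAt.tendsto
    rwa [hκ₀] at h
  -- the pair `(γ (κ Q), Q)` tends to `(x₀, ↑Q₀)`: pull the localised transfer back to `Q`
  have hpair : Tendsto (fun Q => (γ (κ Q), Q)) (𝓝 (coeField Q₀)) (𝓝 (x₀, coeField Q₀)) :=
    (hγt.comp hκt).prodMk_nhds tendsto_id
  have htrQ : ∀ᶠ Q in 𝓝 (coeField Q₀), ∀ (U' Q' : GaugeField P 0 SU2) (μ : F →L[ℂ] ℂ), χ (γ (κ Q)) = coeField U' → coeField Q' = Q →
      Φ (γ (κ Q)) = κ Q → fderiv ℂ a (γ (κ Q)) = μ.comp (fderiv ℂ Φ (γ (κ Q))) →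
        (starL ℂ : ℂ ≃L⋆[ℂ] ℂ).toContinuousLinearMap.comp (μ.comp cF) = μ →
          U' ∈ reg ∧ AgreeOn 𝔹 (avgFamily av U') (avgFamily av Q') ∧ Crit Q' U' :=
    hpair.eventually htransfer
  -- continuity of `Γ = χ ∘ γ ∘ κ` at the base datum and the entry bound there
  have hΓc : ContinuousAt (fun Q => χ (γ (κ Q))) (coeField Q₀) := by
    have h1 : ContinuousAt χ (γ (κ (coeField Q₀))) := by
      rw [hκ₀, hγ0]; exact hχ.self_of_nhds.continuousAt
    have h2 : ContinuousAt γ (κ (coeField Q₀)) := by rw [hκ₀]; exact hγc.continuousAt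
    have h3 : ContinuousAt (fun Q => γ (κ Q)) (coeField Q₀) := h2.comp hκ.self_of_nhds.continuousAt
    exact ContinuousAt.comp (f := fun Q => γ (κ Q)) h1 h3
  have hbase : ∀ b i j, ‖χ (γ (κ (coeField Q₀))) b i j‖ < 𝓐₀ := fun b i j => by
    rw [hκ₀, hγ0]
    have hθ : χ x₀ b = (star (χ x₀ b))⁻¹ := by
      have h := hχθ x₀ b
      rwa [hx₀] at h
    exact lt_of_le_of_lt (norm_entry_le_one_of_theta_fixed hθ (hχdet x₀ b) i j) h𝓐₀
  have hbound : ∀ᶠ Q in 𝓝 (coeField Q₀), ∀ b i j, ‖χ (γ (κ Q)) b i j‖ < 𝓐₀ := by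
    refine eventually_all.2 fun b => eventually_all.2 fun i => eventually_all.2 fun j => ?_
    have hc : ContinuousAt (fun Q => ‖χ (γ (κ Q)) b i j‖) (coeField Q₀) :=
      ((continuous_apply j).continuousAt.comp ((continuous_apply i).continuousAt.comp
        ((continuous_apply b).continuousAt.comp hΓc))).norm
    exact hc.eventually (gt_mem_nhds (hbase b i j))
  -- the good set of data and the open chart domain
  have hS : ∀ᶠ Q in 𝓝 (coeField Q₀), DifferentiableAt ℂ κ Q ∧ (∀ b i j, ‖χ (γ (κ Q)) b i j‖ < 𝓐₀) ∧
      (∀ Q' : GaugeField P 0 SU2, coeField Q' = Q → cF (κ Q) = κ Q) ∧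
      (∀ U' Q' : GaugeField P 0 SU2, coeField Q' = Q →
        U' ∈ reg → AgreeOn 𝔹 (avgFamily av U') (avgFamily av Q') → Crit Q' U' → IsMinimizer av reg 𝔹 (avgFamily av Q') U') ∧
      ((Φ (γ (κ Q)) = κ Q ∧ ContDiffAt ℂ m γ (κ Q) ∧
        fderiv ℂ a (γ (κ Q)) = (Λ (κ Q)).comp (fderiv ℂ Φ (γ (κ Q))) ∧
        (cF (κ Q) = κ Q → cE (γ (κ Q)) = γ (κ Q) ∧
          (starL ℂ : ℂ ≃L⋆[ℂ] ℂ).toContinuousLinearMap.comp ((Λ (κ Q)).comp cF) = Λ (κ Q))) ∧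
        DifferentiableAt ℂ χ (γ (κ Q))) ∧
      (∀ (U' Q' : GaugeField P 0 SU2) (μ : F →L[ℂ] ℂ), χ (γ (κ Q)) = coeField U' → coeField Q' = Q →
        Φ (γ (κ Q)) = κ Q → fderiv ℂ a (γ (κ Q)) = μ.comp (fderiv ℂ Φ (γ (κ Q))) →
          (starL ℂ : ℂ ≃L⋆[ℂ] ℂ).toContinuousLinearMap.comp (μ.comp cF) = μ →
            U' ∈ reg ∧ AgreeOn 𝔹 (avgFamily av U') (avgFamily av Q') ∧ Crit Q' U') :=
    hκ.and (hbound.and (hκreal.and (hT1u.and ((hκt.eventually hG).and htrQ))))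
  obtain ⟨S, hSsub, hSopen, hSmem⟩ := _root_.mem_nhds_iff.1 hS
  refine ⟨S, hSopen, hSmem, fun Q => χ (γ (κ Q)), fun b i j => ?_, fun Q hQ b i j => le_of_lt ((hSsub hQ).2.1 b i j), fun Q' hQ' => ?_⟩
  · intro Q hQ
    obtain ⟨hκQ, -, -, -, ⟨⟨-, hγQ, -, -⟩, hχQ⟩, -⟩ := hSsub hQ
    have h : DifferentiableAt ℂ (fun Q => χ (γ (κ Q))) Q := hχQ.comp Q ((hγQ.differentiableAt hm).comp Q hκQ)
    have hb : DifferentiableAt ℂ (fun Q => χ (γ (κ Q)) b) Q := (differentiableAt_pi.1 h) b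
    exact (((differentiable_entry i j) _).comp Q hb).differentiableWithinAt
  · obtain ⟨-, -, hκr, hT, ⟨⟨hfib, -, hlag, hrealQ⟩, -⟩, htr⟩ := hSsub hQ'
    obtain ⟨hfix, hμ⟩ := hrealQ (hκr Q' rfl)
    have hmem : ∀ b, χ (γ (κ (coeField Q'))) b ∈ Matrix.specialUnitaryGroup (Fin 2) ℂ := fun b => by
      refine mem_specialUnitaryGroup_of_theta_fixed ?_ (hχdet _ b)
      have h := hχθ (γ (κ (coeField Q'))) b
      rwa [hfix] at h
    let U' : GaugeField P 0 SU2 := fun b => ⟨χ (γ (κ (coeField Q'))) b, hmem b⟩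
    have hU' : χ (γ (κ (coeField Q'))) = coeField U' := funext fun b => rfl
    obtain ⟨hreg, hagree, hcritQ⟩ := htr U' Q' (Λ (κ (coeField Q'))) hU' rfl hfib hlag hμ
    exact ⟨U', fun b => rfl, hT U' Q' rfl hreg hagree hcritQ⟩

end ChartLocal

/-! ## §5  (v1.1, append-only) The letter (J0′) `hMin` from a family of complex Lagrange systems — localised transfers -/

section RecordLocal

variable {P : Params} {k : ℕ}
  {E : Type*} [NormedAddCommGroup E] [NormedSpace ℂ E] [FiniteDimensional ℂ E]
  {F : Type*} [NormedAddCommGroup F] [NormedSpace ℂ F] [FiniteDimensional ℂ F]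

/-- ★★★ **THE LETTER (J0′) `hMin` FROM A FAMILY OF COMPLEX LAGRANGE SYSTEMS, LOCALISED TRANSFERS** — `hMin_of_criticalFamilies` with each `V_k`'s transfer asked only near the pair
`(x₀ V_k, ↑(Q_k^{s*}(ext V_k)))`. [cite: Balaban1985Variational, Thm 1 p.279, Sect. G pp.305–307, Prop. 9 (190) p.309; Balaban1989LargeFieldI, (1.74) p.192, Prop. 1 p.194 (last clause); Balaban1988Convergent, (2.11)–(2.14) pp.256–257; LuenbergerYe2008, §10.7 pp.306–307] -/
theorem hMin_of_criticalFamilies_local (Λ : Set (Site P k)) (lo hi : Fin P.d → ℤ)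
    (av : ∀ j, Averaging P j SU2) (reg : Set (GaugeField P 0 SU2)) (𝔹 : DetSet P)
    (ext : GaugeField P k SU2 → GaugeField P k SU2) (hext : ∀ W, ext W = extend Λ (shellGauge W lo hi) W)
    {K : Set (GaugeField P k SU2)} (hK : IsCompact K) {𝓐₀ : ℝ} (h𝓐₀ : 1 < 𝓐₀)
    (cE : E →L⋆[ℂ] E) (cF : F →L⋆[ℂ] F) (hcE : ∀ x, cE (cE x) = x) (hcF : ∀ y, cF (cF y) = y)
    {m : WithTop ℕ∞} (hm : m ≠ 0) (hm' : m ≠ (⊤ : ℕ∞))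
    (a : GaugeField P k SU2 → E → ℂ) (Φ : GaugeField P k SU2 → E → F) (x₀ : GaugeField P k SU2 → E)
    (ℓ₀ : GaugeField P k SU2 → (F →L[ℂ] ℂ))
    (χ : GaugeField P k SU2 → E → PBond P 0 → Matrix (Fin 2) (Fin 2) ℂ)
    (κ : GaugeField P k SU2 → (PBond P 0 → Matrix (Fin 2) (Fin 2) ℂ) → F)
    (Crit : GaugeField P 0 SU2 → GaugeField P 0 SU2 → Prop)
    (hsys : ∀ Vk ∈ K, ContDiffAt ℂ (m + 1) (a Vk) (x₀ Vk) ∧ ContDiffAt ℂ (m + 1) (Φ Vk) (x₀ Vk) ∧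
      fderiv ℂ (a Vk) (x₀ Vk) = (ℓ₀ Vk).comp (fderiv ℂ (Φ Vk) (x₀ Vk)) ∧ Function.Surjective (fderiv ℂ (Φ Vk) (x₀ Vk)) ∧
      (∀ s : E, fderiv ℂ (Φ Vk) (x₀ Vk) s = 0 →
        (∀ t : E, fderiv ℂ (Φ Vk) (x₀ Vk) t = 0 →
          fderiv ℂ (fderiv ℂ (a Vk)) (x₀ Vk) s t - (ℓ₀ Vk) (fderiv ℂ (fderiv ℂ (Φ Vk)) (x₀ Vk) s t) = 0) → s = 0) ∧
      (∀ x, a Vk (cE x) = conj (a Vk x)) ∧ (∀ x, Φ Vk (cE x) = cF (Φ Vk x)) ∧ cE (x₀ Vk) = x₀ Vk)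
    (hχ : ∀ Vk ∈ K, (∀ᶠ x in 𝓝 (x₀ Vk), DifferentiableAt ℂ (χ Vk) x) ∧
      (∀ x b, χ Vk (cE x) b = (star (χ Vk x b))⁻¹) ∧ ∀ x b, (χ Vk x b).det = 1)
    (hκ : ∀ Vk ∈ K, κ Vk (coeField (qsstarGIter0 k (ext Vk))) = Φ Vk (x₀ Vk) ∧
      (∀ᶠ Q in 𝓝 (coeField (qsstarGIter0 k (ext Vk))), DifferentiableAt ℂ (κ Vk) Q) ∧
      ∀ᶠ Q in 𝓝 (coeField (qsstarGIter0 k (ext Vk))), ∀ Q' : GaugeField P 0 SU2, coeField Q' = Q → cF (κ Vk Q) = κ Vk Q)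
    (htransfer : ∀ Vk ∈ K, ∀ᶠ w in 𝓝 (x₀ Vk, coeField (qsstarGIter0 k (ext Vk))), ∀ (U' Q' : GaugeField P 0 SU2) (μ : F →L[ℂ] ℂ),
      χ Vk w.1 = coeField U' → coeField Q' = w.2 → Φ Vk w.1 = κ Vk w.2 → fderiv ℂ (a Vk) w.1 = μ.comp (fderiv ℂ (Φ Vk) w.1) →
        (starL ℂ : ℂ ≃L⋆[ℂ] ℂ).toContinuousLinearMap.comp (μ.comp cF) = μ →
        U' ∈ reg ∧ AgreeOn 𝔹 (avgFamily av U') (avgFamily av Q') ∧ Crit Q' U')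
    (hT1u : ∀ Vk ∈ K, ∀ᶠ Q in 𝓝 (coeField (qsstarGIter0 k (ext Vk))), ∀ U' Q' : GaugeField P 0 SU2, coeField Q' = Q →
      U' ∈ reg → AgreeOn 𝔹 (avgFamily av U') (avgFamily av Q') → Crit Q' U' → IsMinimizer av reg 𝔹 (avgFamily av Q') U') :
    ∃ R : ℝ, 0 < R ∧ ∀ Vk ∈ K,
      ∃ Ũ : VecField P k (EuclideanSpace ℂ (Fin 3)) × VecField P k (EuclideanSpace ℂ (Fin 3)) → PBond P 0 → Matrix (Fin 2) (Fin 2) ℂ,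
        (∀ b i j, DifferentiableOn ℂ (fun z => Ũ z b i j) (ball 0 R)) ∧
        (∀ z ∈ ball (0 : VecField P k (EuclideanSpace ℂ (Fin 3)) × VecField P k (EuclideanSpace ℂ (Fin 3))) R, ∀ b i j, ‖Ũ z b i j‖ ≤ 𝓐₀) ∧
        ∀ p B' : VecField P k E3, ‖p‖ < R → ‖B'‖ < R → ∃ U' : GaugeField P 0 SU2,
          (∀ b, Ũ (cplxVec p, cplxVec B') b = ((U' b : SU2) : Matrix (Fin 2) (Fin 2) ℂ)) ∧
            IsMinimizer av reg 𝔹 (avgFamily av (qsstarGIter0 k (expMul su2Chart B' (ext (expMul su2Chart p Vk))))) U' := by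
  refine hMin_of_localCharts Λ lo hi av reg 𝔹 ext hK fun Vk hVk => ?_
  obtain ⟨ha, hΦ, hcrit, honto, hnondeg, haE, hΦE, hx₀⟩ := hsys Vk hVk
  obtain ⟨hχd, hχθ, hχdet⟩ := hχ Vk hVk
  obtain ⟨hκ₀, hκd, hκreal⟩ := hκ Vk hVk
  obtain ⟨O, hO, hmem, Γ, hΓd, hΓb, hΓr⟩ := exists_localChart_of_criticalFamily_local av reg 𝔹 cE cF hcE hcF hm hm' ha hΦ hcrit honto hnondeg
    haE hΦE hx₀ (χ Vk) hχd hχθ hχdet (κ Vk) hκ₀ hκd hκreal Crit (htransfer Vk hVk) (hT1u Vk hVk) h𝓐₀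
  refine ⟨O, hO, by rwa [datumC_coeField_zero Λ lo hi ext hext], Γ, hΓd, hΓb, fun p B' Vk' hQ' => ?_⟩
  have hreal : datumC Λ lo hi (coeField Vk') (cplxVec p) (cplxVec B') =
      coeField (qsstarGIter0 k (expMul su2Chart B' (ext (expMul su2Chart p Vk')))) := by
    rw [datumC_real, ← hext]
  rw [hreal] at hQ' ⊢
  exact hΓr _ hQ'

end RecordLocal

end Literature.MathematicalPhysics.QuantumFieldTheory.Balaban1983to89.B15Prop1CriticalChartFromIFT

end
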